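import Literature.Topology.FourManifolds.KhBigonHomotopy
import Literature.Topology.FourManifolds.KhCurlRotate
import HarnessLib

/-!
# Invariance of Khovanov homology under the second Reidemeister move (`Ω2a`)

Sibling file of `KhComplex.lean`, assembling `KhBigonHomotopy` (the bigon in normal position)
and `KhComplexTransportProofs` (independence of the base point) into the second-move case of the
named fact `Literature.Topology.FourManifolds.GaussDiagram.nonempty_iso_khovanovHomology_of_equiv`
(Khovanov (2000), Thm. 1) at general positions:

* `omega2a_params` — the adjacency hypotheses of `PolyakMove.omega2a G o u o' u' ε` pin the
  second insertion: `u' = xu + 1` and `o' = xo + 1 + [xu < xo]`, where `xo, xu` are the over-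
  and under-passage of the first new chord in the intermediate diagram;
* `insertChord_insertChord_eq_rotate_bigon` — **the target of `Ω2a` is a rotated bigon**:
  `(G.insertChord o u ε).insertChord o' u' (-ε) = ((G.rotate (2n - u)).bigon m true ε).rotate r'`
  for explicit `m`, `r'`;
* `nonempty_iso_khovanovHomology_omega2a` — **`Kh^{i,j}(G) ≅ Kh^{i,j}((G.insertChord o u ε).insertChord o' u' (-ε))`**
  whenever every edge of the cube of the target is a merge or a split (in particular when the
  target is the diagram of a knot, `…_of_hasGaussDiagram`), and the same over the universal
  Frobenius system (`nonempty_iso_frobeniusHomology_omega2a`).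

Khovanov (2000), §5.3, Thm. 1; Bar-Natan (2002), §4.3; Polyak (2010), §2 (`Ω2a`). No named fact
is introduced.

## References

* M. Khovanov, *A categorification of the Jones polynomial*, Duke Math. J. 101 (2000) 359–426,
  §5.3, Thm. 1. [cite: Khovanov2000, Thm. 1]
* D. Bar-Natan, *On Khovanov's categorification of the Jones polynomial*, Algebr. Geom. Topol. 2
  (2002) 337–370, §4.3. [cite: BarNatan2002, §4]
* M. Polyak, *Minimal generating sets of Reidemeister moves*, Quantum Topol. 1 (2010), §2.
  [cite: Polyak2010, §2]
-/

open Function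

noncomputable section

namespace Literature.Topology.FourManifolds

namespace GaussDiagram

/-! ## Modular arithmetic -/

/-- Reduction modulo `k` of a number below `2k`. [folklore] -/
theorem mod_eq_ite_of_lt {v k : ℕ} (hv : v < 2 * k) :
    v % k = if v < k then v else v - k := by
  split_ifs with h
  · exact Nat.mod_eq_of_lt h
  · rw [show v = (v - k) + k by omega, Nat.add_mod_right, Nat.mod_eq_of_lt (by omega)]
    omega

variable (G : GaussDiagram) (o : Fin (2 * G.n + 2)) (u : Fin (2 * G.n + 1))
  (o' : Fin (2 * (G.n + 1) + 2)) (u' : Fin (2 * (G.n + 1) + 1)) (ε : ℤˣ)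

/-! ## The parameters of `Ω2a` -/

/-- **The adjacency hypotheses of `Ω2a` pin the second insertion.** With `xo = o` and
`xu = o.succAbove u` the passages of the first new chord in the intermediate diagram, the
over-passages of the two new chords are adjacent and so are their under-passages iff
`u' = xu + 1` and `o' = xo + 2` (`xu < xo`) or `o' = xo + 1` (`xo < xu`). [folklore] -/
theorem omega2a_params
    (hover : (((G.insertChord o u ε).insertChord o' u' (-ε)).overPos (Fin.last (G.n + 1)) : ℕ) =
      ((G.insertChord o u ε).insertChord o' u' (-ε)).overPos (Fin.last G.n).castSucc + 1)
    (hunder : (((G.insertChord o u ε).insertChord o' u' (-ε)).underPos (Fin.last (G.n + 1)) : ℕ) =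
      ((G.insertChord o u ε).insertChord o' u' (-ε)).underPos (Fin.last G.n).castSucc + 1) :
    u'.val = (o.succAbove u).val + 1 ∧
      o'.val = (if (o.succAbove u).val < o.val then o.val + 2 else o.val + 1) := by
  have e1 : ((G.insertChord o u ε).insertChord o' u' (-ε)).overPos (Fin.last (G.n + 1)) = o' := insertChord_overPos_last _ _ _ _
  have e2 : ((G.insertChord o u ε).insertChord o' u' (-ε)).overPos (Fin.last G.n).castSucc =
      (G.insertChord o u ε).insEmb o' u' ((G.insertChord o u ε).overPos (Fin.last G.n)) := insertChord_overPos_castSucc_eq _ _ _ _ _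
  have e3 : ((G.insertChord o u ε).insertChord o' u' (-ε)).underPos (Fin.last (G.n + 1)) = o'.succAbove u' := insertChord_underPos_last _ _ _ _
  have e4 : ((G.insertChord o u ε).insertChord o' u' (-ε)).underPos (Fin.last G.n).castSucc =
      (G.insertChord o u ε).insEmb o' u' ((G.insertChord o u ε).underPos (Fin.last G.n)) := insertChord_underPos_castSucc_eq _ _ _ _ _
  rw [e1, e2, val_insEmb, insertChord_overPos_last] at hover
  rw [e3, e4, val_insEmb, insertChord_underPos_last, val_succAbove] at hunder
  have h1 := o.isLt; have h2 := u.isLt; have h3 := o'.isLt; have h4 := u'.isLt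
  have h5 : (o.succAbove u).val ≠ o.val := fun h ↦ Fin.succAbove_ne o u (Fin.ext h)
  rw [val_succAbove] at hunder h5 ⊢
  split_ifs at hover hunder h5 ⊢ <;> omega

/-- The middle position of the normal form of the target of `Ω2a`: the number of old points met
from the under-passage of the second new chord to the over-passage of the first one. [folklore] -/
def omega2aM : Fin (2 * G.n + 1) :=
  ⟨if (o.succAbove u).val < o.val then o.val - (o.succAbove u).val - 1
    else 2 * G.n + 1 + o.val - (o.succAbove u).val, by
    have h1 := o.isLt; have h2 := (o.succAbove u).isLt
    have h5 : (o.succAbove u).val ≠ o.val := fun h ↦ Fin.succAbove_ne o u (Fin.ext h)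
    split_ifs <;> omega⟩

/-- The value of `omega2aM`. [folklore] -/
@[simp] theorem val_omega2aM : (G.omega2aM o u : ℕ) =
    if (o.succAbove u).val < o.val then o.val - (o.succAbove u).val - 1
    else 2 * G.n + 1 + o.val - (o.succAbove u).val := rfl

/-- The rotation bringing the normal form back: the under-passage of the first new chord goes
from `2n + 2` to its position in the target of `Ω2a`. [folklore] -/
def omega2aR' : ℕ :=
  if (o.succAbove u).val < o.val then (o.succAbove u).val + 2
  else if (o.succAbove u).val = 2 * G.n + 1 then 0 else (o.succAbove u).val + 3

/-! ## The target of `Ω2a` is a rotated bigon -/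

section Conjugate

variable {o u o' u'}
variable (hu' : u'.val = (o.succAbove u).val + 1)
  (ho' : o'.val = (if (o.succAbove u).val < o.val then o.val + 2 else o.val + 1))

include hu' ho' in
-- a case analysis over the relative positions of an old point and the four new ones
set_option maxHeartbeats 1600000 in
/-- The over-passage of an old chord: target of `Ω2a` versus rotated bigon. [folklore] -/
theorem val_overPos_omega2a_old (i : Fin G.n) :
    (((G.insertChord o u ε).insertChord o' u' (-ε)).overPos i.castSucc.castSucc : ℕ) =
      (((G.rotate (2 * G.n - u.val)).bigon (G.omega2aM o u) true ε).rotate (G.omega2aR' o u)).overPos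
        ((G.rotate (2 * G.n - u.val)).oldC (G.omega2aM o u) true ε i) := by
  have h1 := o.isLt; have h2 := u.isLt; have hq := (G.overPos i).isLt
  have h5 : (o.succAbove u).val ≠ o.val := fun h ↦ Fin.succAbove_ne o u (Fin.ext h)
  have e1 : ((G.insertChord o u ε).insertChord o' u' (-ε)).overPos i.castSucc.castSucc = (G.insertChord o u ε).insEmb o' u' ((G.insertChord o u ε).overPos i.castSucc) :=
    insertChord_overPos_castSucc_eq _ _ _ _ _
  have e2 : (G.insertChord o u ε).overPos i.castSucc = G.insEmb o u (G.overPos i) :=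
    insertChord_overPos_castSucc_eq _ _ _ _ _
  rw [e1, val_insEmb, e2, val_insEmb, val_rotate_overPos]
  show _ = (((G.rotate (2 * G.n - u.val)).bigon (G.omega2aM o u) true ε).overPos
    ((G.rotate (2 * G.n - u.val)).oldC (G.omega2aM o u) true ε i) + G.omega2aR' o u) % (2 * (G.n + 2))
  rw [val_overPos_bigon_oldC, val_rotate_overPos, val_omega2aM, hu', ho']
  unfold omega2aR'
  rw [val_succAbove] at h5 ⊢
  rw [mod_eq_ite_of_lt (k := 2 * G.n), mod_eq_ite_of_lt (k := 2 * (G.n + 2))]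
  · by_cases hlt : u.val < o.val
    · simp only [if_pos hlt]
      split_ifs <;> omega
    · simp only [if_neg hlt]
      split_ifs <;> omega
  · by_cases hlt : u.val < o.val
    · simp only [if_pos hlt]
      split_ifs <;> omega
    · simp only [if_neg hlt]
      split_ifs <;> omega
  · omega

include hu' ho' in
-- a case analysis over the relative positions of an old point and the four new ones
set_option maxHeartbeats 1600000 in
/-- The under-passage of an old chord: target of `Ω2a` versus rotated bigon. [folklore] -/
theorem val_underPos_omega2a_old (i : Fin G.n) :
    (((G.insertChord o u ε).insertChord o' u' (-ε)).underPos i.castSucc.castSucc : ℕ) =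
      (((G.rotate (2 * G.n - u.val)).bigon (G.omega2aM o u) true ε).rotate (G.omega2aR' o u)).underPos
        ((G.rotate (2 * G.n - u.val)).oldC (G.omega2aM o u) true ε i) := by
  have h1 := o.isLt; have h2 := u.isLt; have hq := (G.underPos i).isLt
  have h5 : (o.succAbove u).val ≠ o.val := fun h ↦ Fin.succAbove_ne o u (Fin.ext h)
  have e1 : ((G.insertChord o u ε).insertChord o' u' (-ε)).underPos i.castSucc.castSucc = (G.insertChord o u ε).insEmb o' u' ((G.insertChord o u ε).underPos i.castSucc) :=
    insertChord_underPos_castSucc_eq _ _ _ _ _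
  have e2 : (G.insertChord o u ε).underPos i.castSucc = G.insEmb o u (G.underPos i) :=
    insertChord_underPos_castSucc_eq _ _ _ _ _
  rw [e1, val_insEmb, e2, val_insEmb, val_rotate_underPos]
  show _ = (((G.rotate (2 * G.n - u.val)).bigon (G.omega2aM o u) true ε).underPos
    ((G.rotate (2 * G.n - u.val)).oldC (G.omega2aM o u) true ε i) + G.omega2aR' o u) % (2 * (G.n + 2))
  rw [val_underPos_bigon_oldC, val_rotate_underPos, val_omega2aM, hu', ho']
  unfold omega2aR'
  rw [val_succAbove] at h5 ⊢
  rw [mod_eq_ite_of_lt (k := 2 * G.n), mod_eq_ite_of_lt (k := 2 * (G.n + 2))]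
  · by_cases hlt : u.val < o.val
    · simp only [if_pos hlt]
      split_ifs <;> omega
    · simp only [if_neg hlt]
      split_ifs <;> omega
  · by_cases hlt : u.val < o.val
    · simp only [if_pos hlt]
      split_ifs <;> omega
    · simp only [if_neg hlt]
      split_ifs <;> omega
  · omega

include hu' ho' in
/-- The over-passage of the first new chord. [folklore] -/
theorem val_overPos_omega2a_bX :
    (((G.insertChord o u ε).insertChord o' u' (-ε)).overPos (Fin.last G.n).castSucc : ℕ) =
      (((G.rotate (2 * G.n - u.val)).bigon (G.omega2aM o u) true ε).rotate (G.omega2aR' o u)).overPos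
        ((G.rotate (2 * G.n - u.val)).bX (G.omega2aM o u) true ε) := by
  have h1 := o.isLt; have h2 := u.isLt; have h3 := u'.isLt
  have h5 : (o.succAbove u).val ≠ o.val := fun h ↦ Fin.succAbove_ne o u (Fin.ext h)
  have e1 : ((G.insertChord o u ε).insertChord o' u' (-ε)).overPos (Fin.last G.n).castSucc = (G.insertChord o u ε).insEmb o' u' ((G.insertChord o u ε).overPos (Fin.last G.n)) :=
    insertChord_overPos_castSucc_eq _ _ _ _ _
  rw [e1, val_insEmb, insertChord_overPos_last, val_rotate_overPos]
  show _ = (((G.rotate (2 * G.n - u.val)).bigon (G.omega2aM o u) true ε).overPos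
    ((G.rotate (2 * G.n - u.val)).bX (G.omega2aM o u) true ε) + G.omega2aR' o u) % (2 * (G.n + 2))
  rw [val_overPos_bigon_bX, val_omega2aM, hu', ho']
  unfold omega2aR'
  rw [val_succAbove] at h5 ⊢
  simp only [if_true]
  rw [mod_eq_ite_of_lt (k := 2 * (G.n + 2))]
  · split_ifs <;> omega
  all_goals first | omega | (split_ifs <;> omega)

include hu' ho' in
/-- The under-passage of the first new chord. [folklore] -/
theorem val_underPos_omega2a_bX :
    (((G.insertChord o u ε).insertChord o' u' (-ε)).underPos (Fin.last G.n).castSucc : ℕ) =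
      (((G.rotate (2 * G.n - u.val)).bigon (G.omega2aM o u) true ε).rotate (G.omega2aR' o u)).underPos
        ((G.rotate (2 * G.n - u.val)).bX (G.omega2aM o u) true ε) := by
  have h1 := o.isLt; have h2 := u.isLt
  have h5 : (o.succAbove u).val ≠ o.val := fun h ↦ Fin.succAbove_ne o u (Fin.ext h)
  have e1 : ((G.insertChord o u ε).insertChord o' u' (-ε)).underPos (Fin.last G.n).castSucc = (G.insertChord o u ε).insEmb o' u' ((G.insertChord o u ε).underPos (Fin.last G.n)) :=
    insertChord_underPos_castSucc_eq _ _ _ _ _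
  rw [e1, val_insEmb, insertChord_underPos_last, val_rotate_underPos]
  show _ = (((G.rotate (2 * G.n - u.val)).bigon (G.omega2aM o u) true ε).underPos
    ((G.rotate (2 * G.n - u.val)).bX (G.omega2aM o u) true ε) + G.omega2aR' o u) % (2 * (G.n + 2))
  rw [val_underPos_bigon_bX, hu', ho']
  unfold omega2aR'
  rw [val_succAbove] at h5 ⊢
  simp only [if_true, rotate_n]
  rw [mod_eq_ite_of_lt (k := 2 * (G.n + 2))]
  · split_ifs <;> omega
  all_goals first | omega | (split_ifs <;> omega)

include ho' in
/-- The over-passage of the second new chord. [folklore] -/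
theorem val_overPos_omega2a_bY :
    (((G.insertChord o u ε).insertChord o' u' (-ε)).overPos (Fin.last (G.n + 1)) : ℕ) =
      (((G.rotate (2 * G.n - u.val)).bigon (G.omega2aM o u) true ε).rotate (G.omega2aR' o u)).overPos
        ((G.rotate (2 * G.n - u.val)).bY (G.omega2aM o u) true ε) := by
  have h1 := o.isLt; have h2 := u.isLt
  have h5 : (o.succAbove u).val ≠ o.val := fun h ↦ Fin.succAbove_ne o u (Fin.ext h)
  have e1 : ((G.insertChord o u ε).insertChord o' u' (-ε)).overPos (Fin.last (G.n + 1)) = o' := insertChord_overPos_last _ _ _ _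
  rw [e1, val_rotate_overPos]
  show _ = (((G.rotate (2 * G.n - u.val)).bigon (G.omega2aM o u) true ε).overPos
    ((G.rotate (2 * G.n - u.val)).bY (G.omega2aM o u) true ε) + G.omega2aR' o u) % (2 * (G.n + 2))
  rw [val_overPos_bigon_bY, val_omega2aM, ho']
  unfold omega2aR'
  rw [val_succAbove] at h5 ⊢
  simp only [if_true]
  rw [mod_eq_ite_of_lt (k := 2 * (G.n + 2))]
  · split_ifs <;> omega
  all_goals first | omega | (split_ifs <;> omega)

include hu' ho' in
/-- The under-passage of the second new chord. [folklore] -/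
theorem val_underPos_omega2a_bY :
    (((G.insertChord o u ε).insertChord o' u' (-ε)).underPos (Fin.last (G.n + 1)) : ℕ) =
      (((G.rotate (2 * G.n - u.val)).bigon (G.omega2aM o u) true ε).rotate (G.omega2aR' o u)).underPos
        ((G.rotate (2 * G.n - u.val)).bY (G.omega2aM o u) true ε) := by
  have h1 := o.isLt; have h2 := u.isLt; have h3 := o'.isLt
  have h5 : (o.succAbove u).val ≠ o.val := fun h ↦ Fin.succAbove_ne o u (Fin.ext h)
  have e1 : ((G.insertChord o u ε).insertChord o' u' (-ε)).underPos (Fin.last (G.n + 1)) = o'.succAbove u' := insertChord_underPos_last _ _ _ _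
  rw [e1, val_succAbove, val_rotate_underPos]
  show _ = (((G.rotate (2 * G.n - u.val)).bigon (G.omega2aM o u) true ε).underPos
    ((G.rotate (2 * G.n - u.val)).bY (G.omega2aM o u) true ε) + G.omega2aR' o u) % (2 * (G.n + 2))
  rw [val_underPos_bigon_bY, hu', ho']
  unfold omega2aR'
  rw [val_succAbove] at h5 ⊢
  simp only [if_true, rotate_n]
  rw [mod_eq_ite_of_lt (k := 2 * (G.n + 2))]
  · split_ifs <;> omega
  all_goals first | omega | (split_ifs <;> omega)

end Conjugate

/-- **The target of `Ω2a` is a rotated bigon**: under the adjacency hypotheses of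
`PolyakMove.omega2a G o u o' u' ε`, the diagram `(G.insertChord o u ε).insertChord o' u' (-ε)`
is the bigon in normal position (over-passages in the middle, under-passages at the end) of the
diagram rotated by `2n - u`, rotated back. GPV (2000), §1.2 (based Gauss diagrams); Polyak
(2010), §2. [cite: Polyak2010, §2] -/
theorem insertChord_insertChord_eq_rotate_bigon
    (hover : (((G.insertChord o u ε).insertChord o' u' (-ε)).overPos (Fin.last (G.n + 1)) : ℕ) =
      ((G.insertChord o u ε).insertChord o' u' (-ε)).overPos (Fin.last G.n).castSucc + 1)
    (hunder : (((G.insertChord o u ε).insertChord o' u' (-ε)).underPos (Fin.last (G.n + 1)) : ℕ) =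
      ((G.insertChord o u ε).insertChord o' u' (-ε)).underPos (Fin.last G.n).castSucc + 1) :
    (G.insertChord o u ε).insertChord o' u' (-ε) =
      ((G.rotate (2 * G.n - u.val)).bigon (G.omega2aM o u) true ε).rotate (G.omega2aR' o u) := by
  obtain ⟨hu', ho'⟩ := G.omega2a_params o u o' u' ε hover hunder
  refine ext_of_val rfl (fun i j hij ↦ ?_) (fun i j hij ↦ ?_) (fun i j hij ↦ ?_)
  · rcases (G.rotate (2 * G.n - u.val)).eq_oldC_or_bX_or_bY (G.omega2aM o u) true ε j with
      ⟨i₀, rfl⟩ | rfl | rfl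
    · obtain rfl : i = i₀.castSucc.castSucc := Fin.ext hij
      exact G.val_overPos_omega2a_old ε hu' ho' i₀
    · obtain rfl : i = (Fin.last G.n).castSucc := Fin.ext hij
      exact G.val_overPos_omega2a_bX ε hu' ho'
    · obtain rfl : i = Fin.last (G.n + 1) := Fin.ext hij
      exact G.val_overPos_omega2a_bY ε ho'
  · rcases (G.rotate (2 * G.n - u.val)).eq_oldC_or_bX_or_bY (G.omega2aM o u) true ε j with
      ⟨i₀, rfl⟩ | rfl | rfl
    · obtain rfl : i = i₀.castSucc.castSucc := Fin.ext hij
      exact G.val_underPos_omega2a_old ε hu' ho' i₀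
    · obtain rfl : i = (Fin.last G.n).castSucc := Fin.ext hij
      exact G.val_underPos_omega2a_bX ε hu' ho'
    · obtain rfl : i = Fin.last (G.n + 1) := Fin.ext hij
      exact G.val_underPos_omega2a_bY ε hu' ho'
  · rcases (G.rotate (2 * G.n - u.val)).eq_oldC_or_bX_or_bY (G.omega2aM o u) true ε j with
      ⟨i₀, rfl⟩ | rfl | rfl
    · obtain rfl : i = i₀.castSucc.castSucc := Fin.ext hij
      have e : ((G.insertChord o u ε).insertChord o' u' (-ε)).sign i₀.castSucc.castSucc = G.sign i₀ :=
        ((G.insertChord o u ε).insertChord_sign_castSucc _ _ _ i₀.castSucc).trans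
          (G.insertChord_sign_castSucc _ _ _ i₀)
      exact e.trans ((G.rotate (2 * G.n - u.val)).sign_bigon_oldC (G.omega2aM o u) true ε i₀).symm
    · obtain rfl : i = (Fin.last G.n).castSucc := Fin.ext hij
      have e : ((G.insertChord o u ε).insertChord o' u' (-ε)).sign (Fin.last G.n).castSucc = ε :=
        ((G.insertChord o u ε).insertChord_sign_castSucc _ _ _ (Fin.last G.n)).trans
          (G.insertChord_sign_last _ _ _)
      exact e.trans ((G.rotate (2 * G.n - u.val)).sign_bigon_bX (G.omega2aM o u) true ε).symm
    · obtain rfl : i = Fin.last (G.n + 1) := Fin.ext hij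
      have e : ((G.insertChord o u ε).insertChord o' u' (-ε)).sign (Fin.last (G.n + 1)) = -ε :=
        (G.insertChord o u ε).insertChord_sign_last _ _ _
      exact e.trans ((G.rotate (2 * G.n - u.val)).sign_bigon_bY (G.omega2aM o u) true ε).symm

/-! ## Merge-or-split is independent of the base point -/

/-- Merge-or-split for a rotated diagram implies merge-or-split for the diagram. [folklore] -/
theorem dichotomy_of_rotate (H : GaussDiagram) (k : ℕ)
    (hms : ∀ (τ : (H.rotate k).State) (j : Fin (H.rotate k).n), τ j = false →
      (H.rotate k).IsMergeAt τ j ∨ (H.rotate k).IsSplitAt τ j)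
    (σ : H.State) (i : Fin H.n) (hσ : σ i = false) : H.IsMergeAt σ i ∨ H.IsSplitAt σ i := by
  rcases hms ((H.rotateTransfer k).stateMap σ) ((H.rotateTransfer k).chord i)
    (by rw [Transfer.stateMap_apply_chord]; exact hσ) with h | h
  · exact Or.inl (((H.rotateTransfer k).isMergeAt_iff σ i).1 h)
  · exact Or.inr (((H.rotateTransfer k).isSplitAt_iff σ i).1 h)

/-! ## The second Reidemeister move -/

section Omega2a

variable
  (hover : (((G.insertChord o u ε).insertChord o' u' (-ε)).overPos (Fin.last (G.n + 1)) : ℕ) =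
    ((G.insertChord o u ε).insertChord o' u' (-ε)).overPos (Fin.last G.n).castSucc + 1)
  (hunder : (((G.insertChord o u ε).insertChord o' u' (-ε)).underPos (Fin.last (G.n + 1)) : ℕ) =
    ((G.insertChord o u ε).insertChord o' u' (-ε)).underPos (Fin.last G.n).castSucc + 1)
  (hms : ∀ (τ : ((G.insertChord o u ε).insertChord o' u' (-ε)).State)
    (j : Fin ((G.insertChord o u ε).insertChord o' u' (-ε)).n), τ j = false →
    ((G.insertChord o u ε).insertChord o' u' (-ε)).IsMergeAt τ j ∨
      ((G.insertChord o u ε).insertChord o' u' (-ε)).IsSplitAt τ j)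

include hover hunder hms in
/-- **Integral Khovanov homology is invariant under `Ω2a`**: for every Gauss diagram `G` and
every instance of `PolyakMove.omega2a G o u o' u' ε` all of whose cube edges are merges or
splits, `Kh^{i,j}(G) ≅ Kh^{i,j}((G.insertChord o u ε).insertChord o' u' (-ε))`. Khovanov (2000),
§5.3, Thm. 1; Bar-Natan (2002), §4.3; Polyak (2010), §2. [cite: Khovanov2000, Thm. 1] -/
theorem nonempty_iso_khovanovHomology_omega2a (i j : ℤ) :
    Nonempty (G.khovanovHomology i j ≅
      ((G.insertChord o u ε).insertChord o' u' (-ε)).khovanovHomology i j) := by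
  rw [G.insertChord_insertChord_eq_rotate_bigon o u o' u' ε hover hunder] at hms ⊢
  obtain ⟨e₁⟩ := G.nonempty_iso_khovanovHomology_rotate (2 * G.n - u.val) i j
  obtain ⟨e₂⟩ := (G.rotate (2 * G.n - u.val)).nonempty_iso_khovanovHomology_bigon (G.omega2aM o u)
    true ε (dichotomy_of_rotate _ _ hms) i j
  obtain ⟨e₃⟩ := ((G.rotate (2 * G.n - u.val)).bigon (G.omega2aM o u) true ε).nonempty_iso_khovanovHomology_rotate
    (G.omega2aR' o u) i j
  exact ⟨e₁ ≪≫ e₂ ≪≫ e₃⟩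

include hover hunder hms in
/-- **The homology over the universal Frobenius system is invariant under `Ω2a`**, every
`(R, h, t)`, for instances all of whose cube edges are merges or splits. Khovanov (2000), §5.3;
Khovanov (2006). [cite: Khovanov2000, Thm. 1] -/
theorem nonempty_iso_frobeniusHomology_omega2a {R : Type} [CommRing R] (hR tR : R) (i : ℤ) :
    Nonempty (G.frobeniusHomology R hR tR i ≅
      ((G.insertChord o u ε).insertChord o' u' (-ε)).frobeniusHomology R hR tR i) := by
  rw [G.insertChord_insertChord_eq_rotate_bigon o u o' u' ε hover hunder] at hms ⊢
  obtain ⟨e₁⟩ := G.nonempty_iso_frobeniusHomology_rotate hR tR (2 * G.n - u.val) i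
  obtain ⟨e₂⟩ := (G.rotate (2 * G.n - u.val)).nonempty_iso_frobeniusHomology_bigon (G.omega2aM o u)
    true ε hR tR (dichotomy_of_rotate _ _ hms) i
  obtain ⟨e₃⟩ := ((G.rotate (2 * G.n - u.val)).bigon (G.omega2aM o u) true ε).nonempty_iso_frobeniusHomology_rotate
    hR tR (G.omega2aR' o u) i
  exact ⟨e₁ ≪≫ e₂ ≪≫ e₃⟩

end Omega2a

/-- **Integral Khovanov homology is invariant under `Ω2a` for targets realised by a knot.**
[cite: Khovanov2000, Thm. 1] -/
theorem nonempty_iso_khovanovHomology_omega2a_of_hasGaussDiagram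
    (hover : (((G.insertChord o u ε).insertChord o' u' (-ε)).overPos (Fin.last (G.n + 1)) : ℕ) =
      ((G.insertChord o u ε).insertChord o' u' (-ε)).overPos (Fin.last G.n).castSucc + 1)
    (hunder : (((G.insertChord o u ε).insertChord o' u' (-ε)).underPos (Fin.last (G.n + 1)) : ℕ) =
      ((G.insertChord o u ε).insertChord o' u' (-ε)).underPos (Fin.last G.n).castSucc + 1)
    (hK : ∃ K : Knot, K.HasGaussDiagram ((G.insertChord o u ε).insertChord o' u' (-ε))) (i j : ℤ) :
    Nonempty (G.khovanovHomology i j ≅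
      ((G.insertChord o u ε).insertChord o' u' (-ε)).khovanovHomology i j) :=
  G.nonempty_iso_khovanovHomology_omega2a o u o' u' ε hover hunder
    (fun _ _ hτ ↦ isMergeAt_or_isSplitAt_of_hasGaussDiagram_holds hK hτ) i j

end GaussDiagram

end Literature.Topology.FourManifolds
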